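import Literature.Computability.Complexity.StackInts
import Literature.Computability.Complexity.StackMul
import Literature.Computability.Complexity.StackDiv
import Literature.Computability.Complexity.StackWordArith
import Mathlib.Algebra.Order.Floor.Div
import HarnessLib

/-!
# Signed integers for structured stack programs, II: products, division, comparison

Trunk `CplxCore`, toolkit continuing `StackInts.lean` (difference pairs `(P, Q)` with value
`⟦P⟧ - ⟦Q⟧` on the register type `ZOwn ⊕ AReg`), `StackMul.lean` (`mulOf`: multiplication by an
outer register, most significant bit first) and `StackDiv.lean` (`divOf`: long division with
quotient). Contents:

* `Com.pmac a b d` — **multiply–accumulate on naturals**: `d := ⟦d⟧ + ⟦a⟧·⟦b⟧` (canonical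
  numeral), `a`, `b` preserved, through the bank (`runs_pmac`). Four of them make the product
  of two difference pairs, accumulated sign-free into an accumulator pair
  (`(R₁, R₂) += (P₁,Q₁)·(P₂,Q₂)`: `Com.pmacPair`, `runs_pmacPair`, value `pairVal_pmacPair`).
* `Com.natDivStep`, `Com.pfdiv` — floor division of a canonical pair by a positive natural `d`
  held in `P₂`: `(P₁, Q₁) := (⌊P₁/d⌋, ⌈Q₁/d⌉)`, whose value is `⌊(P₁ - Q₁)/d⌋` on a canonical
  pair (`pairVal_pfdiv`, `runs_pfdiv`, `pfdiv_canonical`).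
* `Com.pneg`, `Com.pabs`, `Com.dblNum`, `Com.pleFlag` — negation (swap the components),
  absolute value on a canonical pair, doubling a numeral, and the signed comparison flag
  `g := [(P₁,Q₁) ≤ (P₂,Q₂)]` (`runs_pleFlag`).
* `cP z`, `cQ z` — the **canonical difference pair** of an integer (`z ≥ 0 ↦ (bin z, [])`,
  `z < 0 ↦ ([], bin |z|)`), and `Com.pediv` — division of canonical pairs with exactly the
  semantics of Lean's `Int.ediv` (`/` on `ℤ`: floor for positive divisors,
  `x / (-d) = -(x / d)`, `x / 0 = 0`), `runs_pediv` with cost `pedivCost L` for operands of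
  length `≤ L`.

These are the arithmetic primitives of the LLL machine (dot products; Cohen's recursion
`u ← (d′u - λλ′)/d` in which the division is Lean's `/`; the rounding `⌊(2λ + d)/(2d)⌋`; the
Lovász comparison).

## References

* D. E. Knuth, *The Art of Computer Programming*, Vol. 2, 3rd ed., Addison-Wesley 1998, §4.3.1,
  Algorithms A, M and D. (Not held.)
-/

namespace Literature.Computability.Complexity

open _root_.Computability AReg

/-- `size (a * b) ≤ |a| + |b|` for numerals `a`, `b`. [folklore] -/
theorem size_mul_le_length (a b : List Bool) : (bitsToNat a * bitsToNat b).size ≤ a.length + b.length := by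
  rw [Nat.size_le, pow_add]
  exact Nat.mul_lt_mul'' (bitsToNat_lt a) (bitsToNat_lt b)

namespace Com

open ZOwn

/-- `pmac a b d`: `d := ⟦d⟧ + ⟦a⟧·⟦b⟧` (canonical), `a`, `b` preserved; bank clean before and
after; uses `M` as the multiplier register. [Knuth 1998, §4.3.1, Algorithms A, M] [folklore] -/
def pmac (a b d : ZOwn) : Com ZReg :=
  copy (.inl a) (.inr .y) (.inr .s) (.inr .t) ;;
  copy (.inl b) (.inr .z) (.inr .s) (.inr .t) ;;
  pour (.inr .z) (.inl .M) ;;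
  mulOf ZOwn.M ;;
  clear (.inr .y) ;;
  move (.inl d) (.inr .y) (.inr .t) ;;
  bk add ;; bk normalize ;;
  move (.inr .x) (.inl d) (.inr .t) ;;
  clear (.inr .y)

/-- The product computed by `mulOf` from zero on a reversed multiplier is the canonical numeral
of the product. [folklore] -/
theorem mulOfRes_reverse_nil (a b : List Bool) :
    mulOfRes b.reverse [] a = encodeNat (bitsToNat a * bitsToNat b) := by
  rw [mulOfRes_nil_eq_encodeNat, List.reverse_reverse]

/-- **Simulation of `pmac`** (bank clean, `M` empty; `a`, `b`, `d` need not be distinct):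
`d := ⟦d⟧ + ⟦a⟧·⟦b⟧`, within `|b|(44(|a|+|b|) + 52) + 100(|a|+|b|+|d|) + 50` steps.
[Knuth 1998, §4.3.1, Algorithms A, M] [folklore] -/
theorem runs_pmac (a b d : ZOwn) (Z : Regs ZOwn) (hM : Z .M = []) :
    Runs (pmac a b d) (Sum.elim Z (AReg.file [] [] [] [] [] [] [] []))
      (Sum.elim (Function.update Z d (encodeNat (bitsToNat (Z d) + bitsToNat (Z a) * bitsToNat (Z b))))
        (AReg.file [] [] [] [] [] [] [] []))
      ((Z b).length * (44 * ((Z a).length + (Z b).length) + 52) +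
        100 * ((Z a).length + (Z b).length + (Z d).length) + 50) := by
  set pa := Z a with hpa
  set pb := Z b with hpb
  set pd := Z d with hpd
  -- copy the operands into the bank
  have h1 := runs_copy (ι := ZReg) (a := .inl a) (b := .inr .y) (t := .inr .s) (u := .inr .t)
    (by simp) (by simp) (by simp) (by decide) (by decide) (by decide)
    (Sum.elim Z (AReg.file [] [] [] [] [] [] [] [])) rfl rfl
  simp only [Sum.elim_inl, Sum.elim_inr, file_y, Sum.update_elim_inr, update_file_y, List.append_nil] at h1
  rw [← hpa] at h1
  have h2 := runs_copy (ι := ZReg) (a := .inl b) (b := .inr .z) (t := .inr .s) (u := .inr .t)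
    (by simp) (by simp) (by simp) (by decide) (by decide) (by decide)
    (Sum.elim Z (AReg.file [] pa [] [] [] [] [] [])) rfl rfl
  simp only [Sum.elim_inl, Sum.elim_inr, file_z, Sum.update_elim_inr, update_file_z, List.append_nil] at h2
  rw [← hpb] at h2
  have h3 := runs_pour (ι := ZReg) (a := .inr .z) (b := .inl .M) (by simp)
    (Sum.elim Z (AReg.file [] pa pb [] [] [] [] []))
  simp only [Sum.elim_inl, Sum.elim_inr, file_z, Sum.update_elim_inr, Sum.update_elim_inl, update_file_z, hM,
    List.append_nil] at h3
  -- multiply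
  have h4 := runs_mulOf (κ := ZOwn) ZOwn.M pb.reverse (Function.update Z .M pb.reverse) [] pa [] [] [] pa.length
    (by simp) (by simpa using bitsToNat_lt pa) (by simp) le_rfl
  rw [Function.update_idem, mulOfRes_reverse_nil, List.length_reverse] at h4
  have hZM : Function.update Z ZOwn.M [] = Z := by rw [← hM, Function.update_eq_self]
  rw [hZM] at h4
  set prod := encodeNat (bitsToNat pa * bitsToNat pb) with hprod
  have hlprod : prod.length ≤ pa.length + pb.length := by
    rw [hprod, TM2Pass.length_encodeNat_eq_size]; exact size_mul_le_length pa pb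
  -- accumulate
  have h5 := runs_clear (ι := ZReg) (.inr .y) (Sum.elim Z (AReg.file prod pa [] [] [] [] [] []))
  simp only [Sum.elim_inr, file_y, Sum.update_elim_inr, update_file_y] at h5
  have h6 := runs_move (ι := ZReg) (a := .inl d) (b := .inr .y) (t := .inr .t) (by simp) (by simp) (by decide)
    (Sum.elim Z (AReg.file prod [] [] [] [] [] [] [])) rfl
  simp only [Sum.elim_inl, Sum.elim_inr, file_y, Sum.update_elim_inl, Sum.update_elim_inr, update_file_y,
    List.append_nil] at h6
  rw [← hpd] at h6
  set Z₁ := Function.update Z d [] with hZ₁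
  have h7 : Runs (bk add) (Sum.elim Z₁ (AReg.file prod pd [] [] [] [] [] []))
      (Sum.elim Z₁ (AReg.file (addRes prod pd) pd [] [] [] [] [] [])) (13 * (prod.length + pd.length) + 12) :=
    (runs_add prod pd [] [] []).inr _
  have h8 : Runs (bk normalize) (Sum.elim Z₁ (AReg.file (addRes prod pd) pd [] [] [] [] [] []))
      (Sum.elim Z₁ (AReg.file (norm (addRes prod pd)) pd [] [] [] [] [] [])) (9 * (addRes prod pd).length + 5) :=
    (runs_normalize (addRes prod pd) pd [] [] [] []).inr _
  have h9 := runs_move (ι := ZReg) (a := .inr .x) (b := .inl d) (t := .inr .t) (by simp) (by decide) (by simp)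
    (Sum.elim Z₁ (AReg.file (norm (addRes prod pd)) pd [] [] [] [] [] [])) rfl
  simp only [Sum.elim_inl, Sum.elim_inr, file_x, Sum.update_elim_inl, Sum.update_elim_inr, update_file_x] at h9
  have hZ₁d : Z₁ d = [] := by rw [hZ₁, Function.update_self]
  rw [hZ₁d, List.append_nil, hZ₁, Function.update_idem] at h9
  have h10 := runs_clear (ι := ZReg) (.inr .y)
    (Sum.elim (Function.update Z d (norm (addRes prod pd))) (AReg.file [] pd [] [] [] [] [] []))
  simp only [Sum.elim_inr, file_y, Sum.update_elim_inr, update_file_y] at h10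
  have hlen := length_addRes_le prod pd
  have hnorm := length_norm_le (addRes prod pd)
  refine (h1.seq (h2.seq (h3.seq (h4.seq (h5.seq (h6.seq (h7.seq (h8.seq (h9.seq h10))))))))).of_eq ?_ ?_
  · rw [norm_eq_encodeNat, bitsToNat_addRes, hprod, bitsToNat_encodeNat, Nat.add_comm]
  · omega

/-- `pmacPair`: `(R₁, R₂) += (P₁, Q₁) · (P₂, Q₂)` as difference pairs:
`R₁ += P₁P₂ + Q₁Q₂`, `R₂ += P₁Q₂ + Q₁P₂` (operands preserved). [folklore] -/
def pmacPair : Com ZReg := pmac .P₁ .P₂ .R₁ ;; pmac .Q₁ .Q₂ .R₁ ;; pmac .P₁ .Q₂ .R₂ ;; pmac .Q₁ .P₂ .R₂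

/-- The cost of `pmacPair` in terms of a common bound `L` on the operand lengths and `D` on the
accumulator lengths. [folklore] -/
def pmacPairCost (L D : ℕ) : ℕ := 4 * (L * (88 * L + 52) + 100 * (4 * L + D + 2) + 50)

/-- **Simulation of `pmacPair`** (bank clean, `M` empty), with operand lengths `≤ L` and
accumulator lengths `≤ D`. [Knuth 1998, §4.3.1, Algorithms A, M] [folklore] -/
theorem runs_pmacPair (p₁ q₁ p₂ q₂ r₁ r₂ ww : List Bool) (L D : ℕ)
    (hp₁ : p₁.length ≤ L) (hq₁ : q₁.length ≤ L) (hp₂ : p₂.length ≤ L) (hq₂ : q₂.length ≤ L)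
    (hr₁ : r₁.length ≤ D) (hr₂ : r₂.length ≤ D) :
    Runs pmacPair (Sum.elim (ZOwn.file p₁ q₁ p₂ q₂ r₁ r₂ [] ww) (AReg.file [] [] [] [] [] [] [] []))
      (Sum.elim (ZOwn.file p₁ q₁ p₂ q₂
        (encodeNat (bitsToNat r₁ + bitsToNat p₁ * bitsToNat p₂ + bitsToNat q₁ * bitsToNat q₂))
        (encodeNat (bitsToNat r₂ + bitsToNat p₁ * bitsToNat q₂ + bitsToNat q₁ * bitsToNat p₂)) [] ww)
        (AReg.file [] [] [] [] [] [] [] []))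
      (pmacPairCost L D) := by
  have h1 := runs_pmac .P₁ .P₂ .R₁ (ZOwn.file p₁ q₁ p₂ q₂ r₁ r₂ [] ww) rfl
  simp only [file_P₁, file_P₂, file_R₁, update_file_R₁] at h1
  set s₁ := encodeNat (bitsToNat r₁ + bitsToNat p₁ * bitsToNat p₂) with hs₁
  have h2 := runs_pmac .Q₁ .Q₂ .R₁ (ZOwn.file p₁ q₁ p₂ q₂ s₁ r₂ [] ww) rfl
  simp only [file_Q₁, file_Q₂, file_R₁, update_file_R₁] at h2
  have es₁ : bitsToNat s₁ = bitsToNat r₁ + bitsToNat p₁ * bitsToNat p₂ := by rw [hs₁, bitsToNat_encodeNat]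
  rw [es₁] at h2
  set s₂ := encodeNat (bitsToNat r₁ + bitsToNat p₁ * bitsToNat p₂ + bitsToNat q₁ * bitsToNat q₂) with hs₂
  have h3 := runs_pmac .P₁ .Q₂ .R₂ (ZOwn.file p₁ q₁ p₂ q₂ s₂ r₂ [] ww) rfl
  simp only [file_P₁, file_Q₂, file_R₂, update_file_R₂] at h3
  set s₃ := encodeNat (bitsToNat r₂ + bitsToNat p₁ * bitsToNat q₂) with hs₃
  have h4 := runs_pmac .Q₁ .P₂ .R₂ (ZOwn.file p₁ q₁ p₂ q₂ s₂ s₃ [] ww) rfl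
  simp only [file_Q₁, file_P₂, file_R₂, update_file_R₂] at h4
  have es₃ : bitsToNat s₃ = bitsToNat r₂ + bitsToNat p₁ * bitsToNat q₂ := by rw [hs₃, bitsToNat_encodeNat]
  rw [es₃] at h4
  -- lengths of the intermediate accumulators
  have hl₁ : s₁.length ≤ 2 * L + D + 1 := by
    rw [hs₁, TM2Pass.length_encodeNat_eq_size, Nat.size_le]
    have h1 := bitsToNat_lt r₁; have h2 := bitsToNat_lt p₁; have h3 := bitsToNat_lt p₂
    have e1 : (2:ℕ) ^ r₁.length ≤ 2 ^ D := Nat.pow_le_pow_right (by norm_num) hr₁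
    have e2 : (2:ℕ) ^ p₁.length ≤ 2 ^ L := Nat.pow_le_pow_right (by norm_num) hp₁
    have e3 : (2:ℕ) ^ p₂.length ≤ 2 ^ L := Nat.pow_le_pow_right (by norm_num) hp₂
    have e4 : (2:ℕ) ^ (2 * L + D + 1) = 2 ^ L * 2 ^ L * 2 ^ D * 2 := by ring
    rw [e4]
    have hp : bitsToNat p₁ * bitsToNat p₂ < 2 ^ L * 2 ^ L := Nat.mul_lt_mul'' (h2.trans_le e2) (h3.trans_le e3)
    have hr : bitsToNat r₁ < 2 ^ D := h1.trans_le e1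
    have hX : 2 ^ L * 2 ^ L ≤ 2 ^ L * 2 ^ L * 2 ^ D := Nat.le_mul_of_pos_right _ (by positivity)
    have hY : 2 ^ D ≤ 2 ^ L * 2 ^ L * 2 ^ D := Nat.le_mul_of_pos_left _ (by positivity)
    omega
  have hl₃ : s₃.length ≤ 2 * L + D + 1 := by
    rw [hs₃, TM2Pass.length_encodeNat_eq_size, Nat.size_le]
    have h1 := bitsToNat_lt r₂; have h2 := bitsToNat_lt p₁; have h3 := bitsToNat_lt q₂
    have e1 : (2:ℕ) ^ r₂.length ≤ 2 ^ D := Nat.pow_le_pow_right (by norm_num) hr₂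
    have e2 : (2:ℕ) ^ p₁.length ≤ 2 ^ L := Nat.pow_le_pow_right (by norm_num) hp₁
    have e3 : (2:ℕ) ^ q₂.length ≤ 2 ^ L := Nat.pow_le_pow_right (by norm_num) hq₂
    have e4 : (2:ℕ) ^ (2 * L + D + 1) = 2 ^ L * 2 ^ L * 2 ^ D * 2 := by ring
    rw [e4]
    have hp : bitsToNat p₁ * bitsToNat q₂ < 2 ^ L * 2 ^ L := Nat.mul_lt_mul'' (h2.trans_le e2) (h3.trans_le e3)
    have hr : bitsToNat r₂ < 2 ^ D := h1.trans_le e1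
    have hX : 2 ^ L * 2 ^ L ≤ 2 ^ L * 2 ^ L * 2 ^ D := Nat.le_mul_of_pos_right _ (by positivity)
    have hY : 2 ^ D ≤ 2 ^ L * 2 ^ L * 2 ^ D := Nat.le_mul_of_pos_left _ (by positivity)
    omega
  refine (h1.seq (h2.seq (h3.seq h4))).of_eq (by rw [hs₂]) ?_
  -- each `pmac` costs at most `L(88L + 52) + 100(4L + D + 2) + 50`
  have hc : ∀ (la lb ld : ℕ), la ≤ L → lb ≤ L → ld ≤ 2 * L + D + 1 →
      lb * (44 * (la + lb) + 52) + 100 * (la + lb + ld) + 50 ≤ L * (88 * L + 52) + 100 * (4 * L + D + 2) + 50 := by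
    intro la lb ld hla hlb hld
    have : lb * (44 * (la + lb) + 52) ≤ L * (88 * L + 52) := Nat.mul_le_mul hlb (by omega)
    omega
  have c1 := hc _ _ _ hp₁ hp₂ (by omega : r₁.length ≤ 2 * L + D + 1)
  have c2 := hc _ _ _ hq₁ hq₂ hl₁
  have c3 := hc _ _ _ hp₁ hq₂ (by omega : r₂.length ≤ 2 * L + D + 1)
  have c4 := hc _ _ _ hq₁ hp₂ hl₃
  unfold pmacPairCost
  omega

/-- **The value accumulated by `pmacPair` is the product of the two difference pairs.**
[folklore] -/
theorem pairVal_pmacPair (p₁ q₁ p₂ q₂ r₁ r₂ : List Bool) :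
    pairVal (encodeNat (bitsToNat r₁ + bitsToNat p₁ * bitsToNat p₂ + bitsToNat q₁ * bitsToNat q₂))
        (encodeNat (bitsToNat r₂ + bitsToNat p₁ * bitsToNat q₂ + bitsToNat q₁ * bitsToNat p₂)) =
      pairVal r₁ r₂ + pairVal p₁ q₁ * pairVal p₂ q₂ := by
  simp only [pairVal, bitsToNat_encodeNat]; push_cast; ring

/-! ### Floor division by a positive natural -/

/-- The remainder register of `remOf`/`divOf` is normal if the start is. [folklore] -/
theorem norm_remOfRes : ∀ (bs acc n : List Bool), norm acc = acc → norm (remOfRes bs acc n) = remOfRes bs acc n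
  | [], _, _, h => h
  | b :: bs, acc, n, _ => norm_remOfRes bs _ n (by rw [remStepRes, norm_norm])

/-- From zero the remainder of `divOf` is the canonical numeral of the remainder. [folklore] -/
theorem remOfRes_nil_eq_encodeNat (bs n : List Bool) (hn : 0 < bitsToNat n) :
    remOfRes bs [] n = encodeNat (bitsToNat bs.reverse % bitsToNat n) := by
  rw [← bitsToNat_remOfRes_nil bs n hn, ← norm_eq_encodeNat, norm_remOfRes bs [] n rfl]

/-- `natDivStep a`: with the divisor in `y` (kept) and the bank otherwise clean: `a := ⟦a⟧ / ⟦y⟧`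
(canonical) and the flag `g := [⟦a⟧ mod ⟦y⟧ ≠ 0]`; uses `M`, `W` (empty before and after).
[Knuth 1998, §4.3.1, Algorithm D] [folklore] -/
def natDivStep (a : ZOwn) : Com ZReg :=
  pour (.inl a) (.inl .M) ;; divOf ZOwn.M ZOwn.W ;;
  pop (.inr .x) (clear (.inr .x) ;; push (.inr .g) true) (clear (.inr .x) ;; push (.inr .g) true) skip ;;
  move (.inl .W) (.inr .x) (.inr .t) ;; bk normalize ;; move (.inr .x) (.inl a) (.inr .t)

/-- Dropping a canonical numeral while recording whether it was nonzero. [folklore] -/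
theorem runs_dropFlag (m : ℕ) (n z : List Bool) (Z : Regs ZOwn) :
    Runs (pop (.inr .x) (clear (.inr .x) ;; push (.inr .g) true) (clear (.inr .x) ;; push (.inr .g) true) skip : Com ZReg)
      (Sum.elim Z (AReg.file (encodeNat m) n z [] [] [] [] []))
      (Sum.elim Z (AReg.file [] n z [] [] [] [] (flag (decide (m ≠ 0))))) (2 * (encodeNat m).length + 4) := by
  rcases he : encodeNat m with _ | ⟨b, w⟩
  · have hm : m = 0 := by simpa [he] using (bitsToNat_encodeNat m).symm
    subst hm
    exact (Runs.pop_nil _ _ (by simp) (Runs.skip _)).of_eq (by simp) (by simp)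
  · have hm : m ≠ 0 := by
      intro h0; subst h0; simp [encodeNat, encodeNum] at he
    have hbody : Runs (clear (.inr .x) ;; push (.inr .g) true : Com ZReg) (Sum.elim Z (AReg.file w n z [] [] [] [] []))
        (Sum.elim Z (AReg.file [] n z [] [] [] [] [true])) (2 * w.length + 1 + 1) := by
      have hc := runs_clear (ι := ZReg) (.inr .x) (Sum.elim Z (AReg.file w n z [] [] [] [] []))
      simp only [Sum.elim_inr, file_x, Sum.update_elim_inr, update_file_x] at hc
      exact hc.seq (Runs.push' (by rw [Sum.update_elim_inr]; simp))
    cases b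
    · exact (Runs.pop_false' _ _ (R₀ := Sum.elim Z (AReg.file w n z [] [] [] [] [])) (w := w) (by simp)
        (by rw [Sum.update_elim_inr]; simp) hbody).of_eq (by simp [hm]) (by simp)
    · exact (Runs.pop_true' _ _ (R₀ := Sum.elim Z (AReg.file w n z [] [] [] [] [])) (w := w) (by simp)
        (by rw [Sum.update_elim_inr]; simp) hbody).of_eq (by simp [hm]) (by simp)

/-- **Simulation of `natDivStep`** (`a ∉ {M, W}`, `M = W = []`, divisor `⟦y⟧ > 0`, `x s t u f g`
empty): `a := ⟦a⟧ / ⟦y⟧`, `g := flag (⟦a⟧ mod ⟦y⟧ ≠ 0)`, within `|a|(41|y| + 75) + 2|y| + 20`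
steps. [Knuth 1998, §4.3.1, Algorithm D] [folklore] -/
theorem runs_natDivStep {a : ZOwn} (haM : a ≠ .M) (haW : a ≠ .W) (Z : Regs ZOwn) (hM : Z .M = []) (hW : Z .W = [])
    (n z : List Bool) (hn : 0 < bitsToNat n) :
    Runs (natDivStep a) (Sum.elim Z (AReg.file [] n z [] [] [] [] []))
      (Sum.elim (Function.update Z a (encodeNat (bitsToNat (Z a) / bitsToNat n)))
        (AReg.file [] n z [] [] [] [] (flag (decide (bitsToNat (Z a) % bitsToNat n ≠ 0)))))
      ((Z a).length * (41 * n.length + 75) + 2 * n.length + 20) := by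
  set pa := Z a with hpa
  have h1 := runs_pour (ι := ZReg) (a := .inl a) (b := .inl .M) (by simpa using haM) (Sum.elim Z (AReg.file [] n z [] [] [] [] []))
  simp only [Sum.elim_inl, Sum.update_elim_inl, hM, List.append_nil] at h1
  rw [← hpa] at h1
  set Z₁ := Function.update (Function.update Z a []) .M pa.reverse with hZ₁
  have h2 := runs_divOf (κ := ZOwn) (m := ZOwn.M) (q := ZOwn.W) (by decide) pa.reverse Z₁ [] n z
    (by simp [hZ₁]) (by simpa using hn) (by simp)
  have hZ₁W : Z₁ .W = [] := by
    rw [hZ₁, Function.update_of_ne (by decide), Function.update_of_ne (Ne.symm haW), hW]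
  rw [hZ₁W, remOfRes_nil_eq_encodeNat _ _ hn, List.reverse_reverse, List.length_reverse] at h2
  set qs := divBits pa.reverse [] n [] with hqs
  set Z₂ := Function.update (Function.update Z₁ .M []) .W qs with hZ₂
  have h3 := runs_dropFlag (bitsToNat pa % bitsToNat n) n z Z₂
  have h4 := runs_move (ι := ZReg) (a := .inl .W) (b := .inr .x) (t := .inr .t) (by simp) (by simp) (by decide)
    (Sum.elim Z₂ (AReg.file [] n z [] [] [] [] (flag (decide (bitsToNat pa % bitsToNat n ≠ 0))))) rfl
  simp only [Sum.elim_inl, Sum.elim_inr, file_x, Sum.update_elim_inl, Sum.update_elim_inr, update_file_x,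
    List.append_nil] at h4
  have hZ₂W : Z₂ .W = qs := by rw [hZ₂, Function.update_self]
  rw [hZ₂W] at h4
  set Z₃ := Function.update Z₂ .W [] with hZ₃
  set fl := flag (decide (bitsToNat pa % bitsToNat n ≠ 0)) with hfl
  have h5 : Runs (bk normalize) (Sum.elim Z₃ (AReg.file qs n z [] [] [] [] fl))
      (Sum.elim Z₃ (AReg.file (norm qs) n z [] [] [] [] fl)) (9 * qs.length + 5) :=
    (runs_normalize qs n z [] [] fl).inr _
  have h6 := runs_move (ι := ZReg) (a := .inr .x) (b := .inl a) (t := .inr .t) (by simp) (by decide) (by simp)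
    (Sum.elim Z₃ (AReg.file (norm qs) n z [] [] [] [] fl)) rfl
  simp only [Sum.elim_inl, Sum.elim_inr, file_x, Sum.update_elim_inl, Sum.update_elim_inr, update_file_x] at h6
  have hZ₃a : Z₃ a = [] := by
    rw [hZ₃, Function.update_of_ne haW, hZ₂, Function.update_of_ne haW, Function.update_of_ne haM, hZ₁,
      Function.update_of_ne haM, Function.update_self]
  rw [hZ₃a, List.append_nil] at h6
  -- the quotient
  have hq : norm qs = encodeNat (bitsToNat pa / bitsToNat n) := by
    rw [norm_eq_encodeNat, hqs, (divOf_div_mod _ _ hn).1, List.reverse_reverse]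
  have hlq : qs.length = pa.length := by rw [hqs, length_divBits, List.length_reverse]; rfl
  have hlr : (encodeNat (bitsToNat pa % bitsToNat n)).length ≤ n.length := by
    rw [TM2Pass.length_encodeNat_eq_size, Nat.size_le]
    exact (Nat.mod_lt _ hn).trans (bitsToNat_lt n)
  have hln : (norm qs).length ≤ pa.length := hlq ▸ length_norm_le qs
  -- the final register file
  have hfin : Function.update Z₃ a (norm qs) = Function.update Z a (encodeNat (bitsToNat pa / bitsToNat n)) := by
    rw [hq, hZ₃, hZ₂, hZ₁]
    funext r
    by_cases hra : r = a
    · subst hra; simp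
    · rw [Function.update_of_ne hra, Function.update_of_ne hra]
      by_cases hrW : r = ZOwn.W
      · subst hrW; simp [hW]
      · rw [Function.update_of_ne hrW, Function.update_of_ne hrW]
        by_cases hrM : r = ZOwn.M
        · subst hrM; simp [hM]
        · rw [Function.update_of_ne hrM, Function.update_of_ne hrM, Function.update_of_ne hra]
  refine (h1.seq (h2.seq (h3.seq (h4.seq (h5.seq h6))))).of_eq (by rw [hfin]) ?_
  have e : pa.length * (41 * n.length + 75) = pa.length * (41 * n.length + 48) + 27 * pa.length := by ring
  rw [hlq, e]
  omega

/-- `pfdiv`: floor division of the canonical pair `(P₁, Q₁)` by the positive natural `⟦P₂⟧`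
(preserved): `P₁ := P₁ / d`, `Q₁ := ⌈Q₁ / d⌉` (computed as the quotient plus one if the
remainder is nonzero); on a canonical pair this is `⌊(P₁ - Q₁)/d⌋` (`pairVal_pfdiv`). Bank clean,
`M = W = []` before and after. [Knuth 1998, §4.3.1, Algorithm D] [folklore] -/
def pfdiv : Com ZReg :=
  copy (.inl .P₂) (.inr .y) (.inr .s) (.inr .t) ;;
  natDivStep .P₁ ;; clear (.inr .g) ;;
  natDivStep .Q₁ ;; clear (.inr .y) ;;
  pop (.inr .g)
    (push (.inr .y) true ;; move (.inl .Q₁) (.inr .x) (.inr .t) ;; bk add ;; bk normalize ;;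
      move (.inr .x) (.inl .Q₁) (.inr .t) ;; clear (.inr .y))
    (push (.inr .y) true ;; move (.inl .Q₁) (.inr .x) (.inr .t) ;; bk add ;; bk normalize ;;
      move (.inr .x) (.inl .Q₁) (.inr .t) ;; clear (.inr .y))
    skip

/-- The ceiling quotient in the shape the machine computes it (quotient, plus one if the remainder
is nonzero); for `d > 0` this is Mathlib's `q ⌈/⌉ d` (`ceilDivNat_eq_ceilDiv`; they differ only at
the junk value `d = 0`). [folklore] -/
def ceilDivNat (q d : ℕ) : ℕ := q / d + (if q % d = 0 then 0 else 1)

/-- `ceilDivNat` is Mathlib's ceiling division `⌈/⌉` for positive divisors. [folklore] -/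
theorem ceilDivNat_eq_ceilDiv (q d : ℕ) (hd : 0 < d) : ceilDivNat q d = q ⌈/⌉ d := by
  rw [Nat.ceilDiv_eq_add_pred_div, ceilDivNat]
  have h := Nat.div_add_mod q d
  have hr : q % d < d := Nat.mod_lt _ hd
  split_ifs with h0
  · rw [h0, add_zero] at h
    rw [← h, add_zero, show d * (q / d) + d - 1 = (d - 1) + d * (q / d) by omega,
      Nat.add_mul_div_left _ _ hd, Nat.div_eq_of_lt (by omega : d - 1 < d), zero_add,
      Nat.mul_div_cancel_left _ hd]
  · conv_rhs => rw [← h, show d * (q / d) + q % d + d - 1 = (q % d + d - 1) + d * (q / d) by omega,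
      Nat.add_mul_div_left _ _ hd]
    have : (q % d + d - 1) / d = 1 := Nat.div_eq_of_lt_le (by omega) (by omega)
    omega

/-- **Floor division in integers from the two natural quotients**: on a canonical pair
(`p = 0` or `q = 0`), `p / d - ⌈q / d⌉ = ⌊(p - q) / d⌋`. [folklore] -/
theorem pairVal_pfdiv (p q d : ℕ) (hd : 0 < d) (hcanon : p = 0 ∨ q = 0) :
    ((p / d : ℕ) : ℤ) - (ceilDivNat q d : ℤ) = ((p : ℤ) - q) / (d : ℤ) := by
  rcases hcanon with rfl | rfl
  · simp only [Nat.zero_div, Nat.cast_zero, zero_sub, ceilDivNat]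
    symm
    rw [Int.ediv_eq_iff_of_pos (by exact_mod_cast hd)]
    have hq := Nat.div_add_mod q d
    have hr := Nat.mod_lt q hd
    split_ifs with h0
    · constructor
      · push_cast; rw [h0] at hq; nlinarith
      · push_cast; rw [h0] at hq; nlinarith
    · constructor
      · push_cast; nlinarith
      · push_cast
        have : 0 < q % d := Nat.pos_of_ne_zero h0
        nlinarith
  · simp only [ceilDivNat, Nat.zero_div, Nat.zero_mod, Nat.cast_zero, sub_zero]
    exact (Int.natCast_ediv p d).symm ▸ rfl

/-- The conditional increment of `Q₁` at the end of `pfdiv`. [folklore] -/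
theorem runs_pfdiv_adj (m : ℕ) (c : Bool) (p₁ p₂ q₂ r₁ r₂ ww z : List Bool) :
    Runs (pop (.inr .g)
        (push (.inr .y) true ;; move (.inl .Q₁) (.inr .x) (.inr .t) ;; bk add ;; bk normalize ;;
          move (.inr .x) (.inl .Q₁) (.inr .t) ;; clear (.inr .y))
        (push (.inr .y) true ;; move (.inl .Q₁) (.inr .x) (.inr .t) ;; bk add ;; bk normalize ;;
          move (.inr .x) (.inl .Q₁) (.inr .t) ;; clear (.inr .y))
        skip : Com ZReg)
      (Sum.elim (ZOwn.file p₁ (encodeNat m) p₂ q₂ r₁ r₂ [] ww) (AReg.file [] [] z [] [] [] [] (flag c)))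
      (Sum.elim (ZOwn.file p₁ (encodeNat (m + c.toNat)) p₂ q₂ r₁ r₂ [] ww) (AReg.file [] [] z [] [] [] [] []))
      (34 * (encodeNat m).length + 72) := by
  set em := encodeNat m with hem
  cases c
  · exact (Runs.pop_nil _ _ (by simp) (Runs.skip _)).of_eq (by simp [hem]) (by simp)
  · have h1 : Runs (push (.inr .y) true : Com ZReg) (Sum.elim (ZOwn.file p₁ em p₂ q₂ r₁ r₂ [] ww) (AReg.file [] [] z [] [] [] [] []))
        (Sum.elim (ZOwn.file p₁ em p₂ q₂ r₁ r₂ [] ww) (AReg.file [] [true] z [] [] [] [] [])) 1 :=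
      Runs.push' (by rw [Sum.update_elim_inr]; simp)
    have h2 := runs_move (ι := ZReg) (a := .inl .Q₁) (b := .inr .x) (t := .inr .t) (by simp) (by simp) (by decide)
      (Sum.elim (ZOwn.file p₁ em p₂ q₂ r₁ r₂ [] ww) (AReg.file [] [true] z [] [] [] [] [])) rfl
    simp only [Sum.elim_inl, Sum.elim_inr, file_x, Sum.update_elim_inl, Sum.update_elim_inr, update_file_x,
      ZOwn.file_Q₁, ZOwn.update_file_Q₁, List.append_nil] at h2
    have h3 : Runs (bk add) (Sum.elim (ZOwn.file p₁ [] p₂ q₂ r₁ r₂ [] ww) (AReg.file em [true] z [] [] [] [] []))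
        (Sum.elim (ZOwn.file p₁ [] p₂ q₂ r₁ r₂ [] ww) (AReg.file (addRes em [true]) [true] z [] [] [] [] []))
        (13 * (em.length + 1) + 12) := (runs_add em [true] z [] []).inr _
    have h4 : Runs (bk normalize) (Sum.elim (ZOwn.file p₁ [] p₂ q₂ r₁ r₂ [] ww) (AReg.file (addRes em [true]) [true] z [] [] [] [] []))
        (Sum.elim (ZOwn.file p₁ [] p₂ q₂ r₁ r₂ [] ww) (AReg.file (norm (addRes em [true])) [true] z [] [] [] [] []))
        (9 * (addRes em [true]).length + 5) := (runs_normalize (addRes em [true]) [true] z [] [] []).inr _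
    have h5 := runs_move (ι := ZReg) (a := .inr .x) (b := .inl .Q₁) (t := .inr .t) (by simp) (by decide) (by simp)
      (Sum.elim (ZOwn.file p₁ [] p₂ q₂ r₁ r₂ [] ww) (AReg.file (norm (addRes em [true])) [true] z [] [] [] [] [])) rfl
    simp only [Sum.elim_inl, Sum.elim_inr, file_x, Sum.update_elim_inl, Sum.update_elim_inr, update_file_x,
      ZOwn.file_Q₁, ZOwn.update_file_Q₁, List.append_nil] at h5
    have h6 := runs_clear (ι := ZReg) (.inr .y)
      (Sum.elim (ZOwn.file p₁ (norm (addRes em [true])) p₂ q₂ r₁ r₂ [] ww) (AReg.file [] [true] z [] [] [] [] []))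
    simp only [Sum.elim_inr, file_y, Sum.update_elim_inr, update_file_y] at h6
    have hlen := length_addRes_le em [true]
    have hnorm := length_norm_le (addRes em [true])
    refine (Runs.pop_true' _ _ (R₀ := Sum.elim (ZOwn.file p₁ em p₂ q₂ r₁ r₂ [] ww) (AReg.file [] [] z [] [] [] [] []))
      (w := []) (by simp) (by rw [Sum.update_elim_inr]; simp) (h1.seq (h2.seq (h3.seq (h4.seq (h5.seq h6)))))).of_eq ?_ ?_
    · rw [norm_eq_encodeNat, bitsToNat_addRes, hem, bitsToNat_encodeNat]; simp
    · simp only [List.length_singleton] at hlen ⊢; omega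

/-- **Simulation of `pfdiv`** (bank clean, `M = W = []`, `⟦P₂⟧ > 0`).
[Knuth 1998, §4.3.1, Algorithm D] [folklore] -/
theorem runs_pfdiv (p q dd q₂ r₁ r₂ : List Bool) (hd : 0 < bitsToNat dd) :
    Runs pfdiv (Sum.elim (ZOwn.file p q dd q₂ r₁ r₂ [] []) (AReg.file [] [] [] [] [] [] [] []))
      (Sum.elim (ZOwn.file (encodeNat (bitsToNat p / bitsToNat dd))
        (encodeNat (ceilDivNat (bitsToNat q) (bitsToNat dd))) dd q₂ r₁ r₂ [] []) (AReg.file [] [] [] [] [] [] [] []))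
      ((p.length + q.length) * (41 * dd.length + 75) + 54 * dd.length + 34 * q.length + 160) := by
  have h1 := runs_copy (ι := ZReg) (a := .inl .P₂) (b := .inr .y) (t := .inr .s) (u := .inr .t)
    (by simp) (by simp) (by simp) (by decide) (by decide) (by decide)
    (Sum.elim (ZOwn.file p q dd q₂ r₁ r₂ [] []) (AReg.file [] [] [] [] [] [] [] [])) rfl rfl
  simp only [Sum.elim_inl, Sum.elim_inr, file_y, Sum.update_elim_inr, update_file_y, ZOwn.file_P₂, List.append_nil] at h1
  have h2 := runs_natDivStep (a := .P₁) (by decide) (by decide) (ZOwn.file p q dd q₂ r₁ r₂ [] []) rfl rfl dd [] hd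
  simp only [ZOwn.file_P₁, ZOwn.update_file_P₁] at h2
  set p' := encodeNat (bitsToNat p / bitsToNat dd) with hp'
  have h3 := runs_clear (ι := ZReg) (.inr .g)
    (Sum.elim (ZOwn.file p' q dd q₂ r₁ r₂ [] []) (AReg.file [] dd [] [] [] [] [] (flag (decide (bitsToNat p % bitsToNat dd ≠ 0)))))
  simp only [Sum.elim_inr, file_g, Sum.update_elim_inr, update_file_g] at h3
  have h4 := runs_natDivStep (a := .Q₁) (by decide) (by decide) (ZOwn.file p' q dd q₂ r₁ r₂ [] []) rfl rfl dd [] hd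
  simp only [ZOwn.file_Q₁, ZOwn.update_file_Q₁] at h4
  set q' := encodeNat (bitsToNat q / bitsToNat dd) with hq'
  set c := decide (bitsToNat q % bitsToNat dd ≠ 0) with hc
  have h5 := runs_clear (ι := ZReg) (.inr .y) (Sum.elim (ZOwn.file p' q' dd q₂ r₁ r₂ [] []) (AReg.file [] dd [] [] [] [] [] (flag c)))
  simp only [Sum.elim_inr, file_y, Sum.update_elim_inr, update_file_y] at h5
  have h6 := runs_pfdiv_adj (bitsToNat q / bitsToNat dd) c p' dd q₂ r₁ r₂ [] []
  rw [← hq'] at h6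
  have hflag : (flag (decide (bitsToNat p % bitsToNat dd ≠ 0))).length ≤ 1 := by
    cases decide (bitsToNat p % bitsToNat dd ≠ 0) <;> simp
  have hlq' : q'.length ≤ q.length := by
    rw [hq', TM2Pass.length_encodeNat_eq_size, Nat.size_le]
    exact (Nat.div_le_self _ _).trans_lt (bitsToNat_lt q)
  refine (h1.seq (h2.seq (h3.seq (h4.seq (h5.seq h6))))).of_eq ?_ ?_
  · simp only [ceilDivNat, hc]
    congr 2
    by_cases h0 : bitsToNat q % bitsToNat dd = 0 <;> simp [h0]
  · nlinarith [hflag, hlq', Nat.add_mul p.length q.length (41 * dd.length + 75)]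

/-! ### Negation, absolute value, doubling, comparison -/

/-- Doubling a canonical numeral. [folklore] -/
theorem encodeNat_two_mul (n : ℕ) (hn : 0 < n) : encodeNat (2 * n) = false :: encodeNat n := by
  have hne : encodeNat n ≠ [] := by
    intro h0; have := bitsToNat_encodeNat n; rw [h0] at this; simp at this; omega
  have h1 : norm (false :: encodeNat n) = false :: encodeNat n := by
    rw [norm_cons, norm_encodeNat, if_neg hne]
  rw [← h1, norm_eq_encodeNat]
  congr 1; simp

/-- `pneg`: `(P₁, Q₁) := (Q₁, P₁)` (negation), through the empty register `M`. [folklore] -/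
def pneg : Com ZReg :=
  move (.inl .P₁) (.inl .M) (.inr .t) ;; move (.inl .Q₁) (.inl .P₁) (.inr .t) ;; move (.inl .M) (.inl .Q₁) (.inr .t)

/-- **Simulation of `pneg`** (`M = []`, bank `t` empty). [folklore] -/
theorem runs_pneg (p q p₂ q₂ r₁ r₂ ww : List Bool) (B : Regs AReg) (hBt : B .t = []) :
    Runs pneg (Sum.elim (ZOwn.file p q p₂ q₂ r₁ r₂ [] ww) B) (Sum.elim (ZOwn.file q p p₂ q₂ r₁ r₂ [] ww) B)
      (12 * (p.length + q.length) + 6) := by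
  have h1 := runs_move (ι := ZReg) (a := .inl .P₁) (b := .inl .M) (t := .inr .t) (by decide) (by simp) (by simp)
    (Sum.elim (ZOwn.file p q p₂ q₂ r₁ r₂ [] ww) B) (by simpa using hBt)
  simp only [Sum.elim_inl, ZOwn.file_P₁, ZOwn.file_M, Sum.update_elim_inl, ZOwn.update_file_P₁, ZOwn.update_file_M,
    List.append_nil] at h1
  have h2 := runs_move (ι := ZReg) (a := .inl .Q₁) (b := .inl .P₁) (t := .inr .t) (by decide) (by simp) (by simp)
    (Sum.elim (ZOwn.file [] q p₂ q₂ r₁ r₂ p ww) B) (by simpa using hBt)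
  simp only [Sum.elim_inl, ZOwn.file_Q₁, ZOwn.file_P₁, Sum.update_elim_inl, ZOwn.update_file_Q₁, ZOwn.update_file_P₁,
    List.append_nil] at h2
  have h3 := runs_move (ι := ZReg) (a := .inl .M) (b := .inl .Q₁) (t := .inr .t) (by decide) (by simp) (by simp)
    (Sum.elim (ZOwn.file q [] p₂ q₂ r₁ r₂ p ww) B) (by simpa using hBt)
  simp only [Sum.elim_inl, ZOwn.file_M, ZOwn.file_Q₁, Sum.update_elim_inl, ZOwn.update_file_M, ZOwn.update_file_Q₁,
    List.append_nil] at h3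
  exact (h1.seq (h2.seq h3)).of_eq rfl (by omega)

/-- `pabs`: `(P₁, Q₁) := (Q₁ ++ P₁, [])` — on a canonical pair the absolute value. [folklore] -/
def pabs : Com ZReg := move (.inl .Q₁) (.inl .P₁) (.inr .t)

/-- **Simulation of `pabs`** (bank `t` empty). [folklore] -/
theorem runs_pabs (p q p₂ q₂ r₁ r₂ mm ww : List Bool) (B : Regs AReg) (hBt : B .t = []) :
    Runs pabs (Sum.elim (ZOwn.file p q p₂ q₂ r₁ r₂ mm ww) B) (Sum.elim (ZOwn.file (q ++ p) [] p₂ q₂ r₁ r₂ mm ww) B)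
      (6 * q.length + 2) := by
  have h1 := runs_move (ι := ZReg) (a := .inl .Q₁) (b := .inl .P₁) (t := .inr .t) (by decide) (by simp) (by simp)
    (Sum.elim (ZOwn.file p q p₂ q₂ r₁ r₂ mm ww) B) (by simpa using hBt)
  simp only [Sum.elim_inl, ZOwn.file_Q₁, ZOwn.file_P₁, Sum.update_elim_inl, ZOwn.update_file_Q₁, ZOwn.update_file_P₁] at h1
  exact h1

/-- `dblNum a`: double the numeral in the own register `a` if it is nonempty. [folklore] -/
def dblNum (a : ZOwn) : Com ZReg :=
  pop (.inl a) (push (.inl a) true ;; push (.inl a) false) (push (.inl a) false ;; push (.inl a) false) skip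

/-- **Simulation of `dblNum`** on a canonical numeral: `bin n ↦ bin (2n)`. [folklore] -/
theorem runs_dblNum (a : ZOwn) (n : ℕ) (Z : Regs ZOwn) (ha : Z a = encodeNat n) (B : Regs AReg) :
    Runs (dblNum a) (Sum.elim Z B) (Sum.elim (Function.update Z a (encodeNat (2 * n))) B) 4 := by
  rcases Nat.eq_zero_or_pos n with rfl | hn
  · have h0 : Z a = [] := by rw [ha]; rfl
    refine (Runs.pop_nil _ _ (by simp [h0]) (Runs.skip _)).of_eq ?_ (by omega)
    rw [show encodeNat (2 * 0) = [] from rfl, ← h0, Function.update_eq_self]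
  · rw [encodeNat_two_mul n hn]
    have hne : encodeNat n ≠ [] := by
      intro h; have := bitsToNat_encodeNat n; rw [h] at this; simp at this; omega
    obtain ⟨b, w, hbw⟩ : ∃ b w, encodeNat n = b :: w := by
      cases h : encodeNat n with | nil => exact absurd h hne | cons b w => exact ⟨b, w, rfl⟩
    have hk : (Sum.elim Z B : Regs ZReg) (.inl a) = b :: w := by simp [ha, hbw]
    have hbody : Runs (push (.inl a) b ;; push (.inl a) false : Com ZReg) (Sum.elim (Function.update Z a w) B)
        (Sum.elim (Function.update Z a (false :: b :: w)) B) 2 :=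
      (Runs.push' (R' := Sum.elim (Function.update Z a (b :: w)) B)
        (by rw [Sum.update_elim_inl]; simp only [Sum.elim_inl, Function.update_self, Function.update_idem])).seq
        (Runs.push' (by rw [Sum.update_elim_inl]; simp only [Sum.elim_inl, Function.update_self, Function.update_idem]))
    rw [hbw]
    cases b
    · exact (Runs.pop_false' _ _ (R₀ := Sum.elim (Function.update Z a w) B) (w := w) hk
        (by rw [Sum.update_elim_inl]) hbody).of_eq rfl (by omega)
    · exact (Runs.pop_true' _ _ (R₀ := Sum.elim (Function.update Z a w) B) (w := w) hk
        (by rw [Sum.update_elim_inl]) hbody).of_eq rfl (by omega)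

/-- `pleFlag`: `g := flag ((P₁,Q₁) ≤ (P₂,Q₂))` as integers: subtract, normalise, test `P₁ = []`.
Contract (`runs_pleFlag`): both pairs are consumed (`P₁ Q₁ P₂ Q₂ := []`), `R₁ R₂ M W` and the bank
register `z` are preserved, the bank registers `x y s t u f g` must be empty beforehand, and `g`
receives the flag. [folklore] -/
def pleFlag : Com ZReg :=
  psub ;; pnorm ;; pop (.inl .P₁) (clear (.inl .P₁)) (clear (.inl .P₁)) (push (.inr .g) true) ;; clear (.inl .Q₁)

/-- On a canonical pair, `P = []` iff the value is `≤ 0`. [folklore] -/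
theorem pnormP_eq_nil_iff (p q : List Bool) : pnormP p q = [] ↔ pairVal p q ≤ 0 := by
  unfold pnormP pairVal
  split_ifs with h
  · constructor
    · intro h0
      have : bitsToNat p - bitsToNat q = 0 := by
        have := bitsToNat_encodeNat (bitsToNat p - bitsToNat q); rw [h0] at this; simpa using this.symm
      omega
    · intro hle
      have : bitsToNat p - bitsToNat q = 0 := by omega
      rw [this]; rfl
  · simp; omega

/-- **Simulation of `pleFlag`** (bank clean): `g := flag (pairVal P₁ Q₁ ≤ pairVal P₂ Q₂)`, the pairs
consumed. [folklore] -/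
theorem runs_pleFlag (p₁ q₁ p₂ q₂ r₁ r₂ mm ww z : List Bool) :
    Runs pleFlag (Sum.elim (ZOwn.file p₁ q₁ p₂ q₂ r₁ r₂ mm ww) (AReg.file [] [] z [] [] [] [] []))
      (Sum.elim (ZOwn.file [] [] [] [] r₁ r₂ mm ww)
        (AReg.file [] [] z [] [] [] [] (flag (decide (pairVal p₁ q₁ ≤ pairVal p₂ q₂)))))
      (180 * (p₁.length + p₂.length + q₁.length + q₂.length) + 400) := by
  have h1 := runs_psub p₁ q₁ p₂ q₂ r₁ r₂ mm ww z [] []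
  set a := encodeNat (bitsToNat p₁ + bitsToNat q₂) with ha
  set b := encodeNat (bitsToNat q₁ + bitsToNat p₂) with hb
  have h2 := runs_pnorm a b [] [] r₁ r₂ mm ww z
  have hval : pairVal (pnormP a b) (pnormQ a b) = pairVal p₁ q₁ - pairVal p₂ q₂ := by
    rw [pairVal_pnorm, ha, hb, pairVal_psub]
  have hla : a.length ≤ p₁.length + q₂.length + 1 := by
    rw [ha, TM2Pass.length_encodeNat_eq_size, Nat.size_le]
    have := bitsToNat_lt p₁; have := bitsToNat_lt q₂
    have e : (2:ℕ) ^ (p₁.length + q₂.length + 1) = 2 ^ p₁.length * 2 ^ q₂.length * 2 := by ring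
    have hX : 2 ^ p₁.length ≤ 2 ^ p₁.length * 2 ^ q₂.length := Nat.le_mul_of_pos_right _ (by positivity)
    have hY : 2 ^ q₂.length ≤ 2 ^ p₁.length * 2 ^ q₂.length := Nat.le_mul_of_pos_left _ (by positivity)
    omega
  have hlb : b.length ≤ q₁.length + p₂.length + 1 := by
    rw [hb, TM2Pass.length_encodeNat_eq_size, Nat.size_le]
    have := bitsToNat_lt q₁; have := bitsToNat_lt p₂
    have e : (2:ℕ) ^ (q₁.length + p₂.length + 1) = 2 ^ q₁.length * 2 ^ p₂.length * 2 := by ring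
    have hX : 2 ^ q₁.length ≤ 2 ^ q₁.length * 2 ^ p₂.length := Nat.le_mul_of_pos_right _ (by positivity)
    have hY : 2 ^ p₂.length ≤ 2 ^ q₁.length * 2 ^ p₂.length := Nat.le_mul_of_pos_left _ (by positivity)
    omega
  set P := pnormP a b with hP
  set Q := pnormQ a b with hQ
  have hlP : P.length ≤ a.length := by
    rw [hP, pnormP]; split_ifs
    · rw [TM2Pass.length_encodeNat_eq_size, Nat.size_le]; exact (Nat.sub_le _ _).trans_lt (bitsToNat_lt a)
    · simp
  have hlQ : Q.length ≤ b.length := by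
    rw [hQ, pnormQ]; split_ifs
    · simp
    · rw [TM2Pass.length_encodeNat_eq_size, Nat.size_le]; exact (Nat.sub_le _ _).trans_lt (bitsToNat_lt b)
  -- the test `P = []`
  have h3 : Runs (pop (.inl .P₁) (clear (.inl .P₁)) (clear (.inl .P₁)) (push (.inr .g) true) : Com ZReg)
      (Sum.elim (ZOwn.file P Q [] [] r₁ r₂ mm ww) (AReg.file [] [] z [] [] [] [] []))
      (Sum.elim (ZOwn.file [] Q [] [] r₁ r₂ mm ww) (AReg.file [] [] z [] [] [] [] (flag (decide (P = [])))))
      (2 * P.length + 3) := by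
    rcases hPe : P with _ | ⟨c, w⟩
    · exact (Runs.pop_nil _ _ (by simp) (Runs.push' (R' := Sum.elim (ZOwn.file [] Q [] [] r₁ r₂ mm ww)
        (AReg.file [] [] z [] [] [] [] [true])) (by rw [Sum.update_elim_inr]; simp))).of_eq (by simp) (by simp)
    · have hc := runs_clear (ι := ZReg) (.inl .P₁) (Sum.elim (ZOwn.file w Q [] [] r₁ r₂ mm ww) (AReg.file [] [] z [] [] [] [] []))
      simp only [Sum.elim_inl, ZOwn.file_P₁, Sum.update_elim_inl, ZOwn.update_file_P₁] at hc
      cases c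
      · exact (Runs.pop_false' _ _ (R₀ := Sum.elim (ZOwn.file w Q [] [] r₁ r₂ mm ww) (AReg.file [] [] z [] [] [] [] []))
          (w := w) (by simp) (by rw [Sum.update_elim_inl]; simp) hc).of_eq (by simp) (by simp)
      · exact (Runs.pop_true' _ _ (R₀ := Sum.elim (ZOwn.file w Q [] [] r₁ r₂ mm ww) (AReg.file [] [] z [] [] [] [] []))
          (w := w) (by simp) (by rw [Sum.update_elim_inl]; simp) hc).of_eq (by simp) (by simp)
  have h4 := runs_clear (ι := ZReg) (.inl .Q₁)
    (Sum.elim (ZOwn.file [] Q [] [] r₁ r₂ mm ww) (AReg.file [] [] z [] [] [] [] (flag (decide (P = [])))))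
  simp only [Sum.elim_inl, ZOwn.file_Q₁, Sum.update_elim_inl, ZOwn.update_file_Q₁] at h4
  have hiff : (P = []) ↔ pairVal p₁ q₁ ≤ pairVal p₂ q₂ := by
    rw [hP, pnormP_eq_nil_iff, ← pairVal_pnorm, hval]; omega
  refine (h1.seq (h2.seq (h3.seq h4))).of_eq (by simp only [hiff]) ?_
  omega

/-! ### Floor division of signed integers (`Int.ediv` semantics) -/

/-- The canonical difference pair of an integer: first component (`bin z` if `z ≥ 0`, else `[]`). [folklore] -/
def cP (z : ℤ) : List Bool := if z < 0 then [] else encodeNat z.natAbs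
/-- Second component of the canonical difference pair (`bin |z|` if `z < 0`, else `[]`). [folklore] -/
def cQ (z : ℤ) : List Bool := if z < 0 then encodeNat z.natAbs else []

/-- Values of the canonical components. [folklore] -/
theorem bitsToNat_cP (z : ℤ) : (bitsToNat (cP z) : ℤ) = if z < 0 then 0 else z := by
  unfold cP; split_ifs with h
  · simp
  · rw [bitsToNat_encodeNat, Int.natAbs_of_nonneg (not_lt.1 h)]
/-- Values of the canonical components. [folklore] -/
theorem bitsToNat_cQ (z : ℤ) : (bitsToNat (cQ z) : ℤ) = if z < 0 then -z else 0 := by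
  unfold cQ; split_ifs with h
  · rw [bitsToNat_encodeNat, Int.ofNat_natAbs_of_nonpos h.le]
  · simp

/-- Lengths of the canonical components. [folklore] -/
theorem length_cP_add_length_cQ (z : ℤ) : (cP z).length + (cQ z).length = (encodeNat z.natAbs).length := by
  unfold cP cQ; split_ifs <;> simp

/-- Negation swaps the canonical components. [folklore] -/
theorem cP_neg (z : ℤ) : cP (-z) = cQ z := by
  unfold cP cQ
  rcases lt_trichotomy z 0 with h | rfl | h
  · rw [if_neg (by omega), if_pos h, Int.natAbs_neg]
  · simp only [neg_zero, lt_self_iff_false, if_false]; decide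
  · rw [if_pos (by omega), if_neg (by omega)]
/-- Negation swaps the canonical components. [folklore] -/
theorem cQ_neg (z : ℤ) : cQ (-z) = cP z := by
  rw [← cP_neg (-z), neg_neg]

/-- **`pfdiv` on a canonical pair by a positive divisor yields the canonical pair of the floor
quotient.** [folklore] -/
theorem pfdiv_canonical (x : ℤ) (d : ℕ) (hd : 0 < d) :
    encodeNat (bitsToNat (cP x) / d) = cP (x / d) ∧ encodeNat (ceilDivNat (bitsToNat (cQ x)) d) = cQ (x / d) := by
  have hval := pairVal_pfdiv (bitsToNat (cP x)) (bitsToNat (cQ x)) d hd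
    (by unfold cP cQ; split_ifs <;> simp)
  have hx : ((bitsToNat (cP x) : ℤ)) - bitsToNat (cQ x) = x := by
    rw [bitsToNat_cP, bitsToNat_cQ]; split_ifs <;> ring
  rw [hx] at hval
  by_cases hneg : x < 0
  · have hP : cP x = [] := by simp [cP, hneg]
    have hQx : cQ x = encodeNat x.natAbs := by simp [cQ, hneg]
    have hlt : x / d < 0 := Int.ediv_neg_of_neg_of_pos hneg (by exact_mod_cast hd)
    have hPr : cP (x / d) = [] := by simp [cP, hlt]
    have hQr : cQ (x / d) = encodeNat (x / d).natAbs := by simp [cQ, hlt]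
    rw [hP, bitsToNat_nil, Nat.zero_div, hPr, hQr]
    refine ⟨by decide, ?_⟩
    congr 1
    rw [hP, bitsToNat_nil, Nat.zero_div, Nat.cast_zero, zero_sub] at hval
    have : ((ceilDivNat (bitsToNat (cQ x)) d : ℕ) : ℤ) = -(x / d) := by linarith
    omega
  · have hQ : cQ x = [] := by simp [cQ, hneg]
    have hge : 0 ≤ x / d := Int.ediv_nonneg (not_lt.1 hneg) (by positivity)
    have hPr : cP (x / d) = encodeNat (x / d).natAbs := by simp [cP, not_lt.2 hge]
    have hQr : cQ (x / d) = [] := by simp [cQ, not_lt.2 hge]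
    rw [hQ, bitsToNat_nil, hPr, hQr]
    refine ⟨?_, by simp [ceilDivNat]; decide⟩
    congr 1
    rw [hQ, bitsToNat_nil] at hval
    simp only [ceilDivNat, Nat.zero_div, Nat.zero_mod, if_true, add_zero, Nat.cast_zero, sub_zero] at hval
    omega

/-- `pediv`: `(P₁, Q₁) := (P₁, Q₁) / (P₂, Q₂)` on canonical pairs with the semantics of Lean's
`Int.ediv` (floor for positive divisors, `x / (-d) = -(x / d)`, `x / 0 = 0`); the divisor pair is
preserved. Bank clean, `M = W = []` before and after. [Knuth 1998, §4.3.1, Algorithm D] [folklore] -/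
def pediv : Com ZReg :=
  pop (.inl .P₂) (push (.inl .P₂) true ;; pfdiv) (push (.inl .P₂) false ;; pfdiv)
    (pop (.inl .Q₂)
      (push (.inl .Q₂) true ;; move (.inl .Q₂) (.inl .P₂) (.inr .t) ;; pfdiv ;;
        move (.inl .P₂) (.inl .Q₂) (.inr .t) ;; pneg)
      (push (.inl .Q₂) false ;; move (.inl .Q₂) (.inl .P₂) (.inr .t) ;; pfdiv ;;
        move (.inl .P₂) (.inl .Q₂) (.inr .t) ;; pneg)
      (clear (.inl .P₁) ;; clear (.inl .Q₁)))

/-- Cost bound of `pediv` with numerator and divisor of length `≤ L`. [folklore] -/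
def pedivCost (L : ℕ) : ℕ := L * (41 * L + 75) + 120 * L + 200

/-- The quotient is not longer than the numerator. [folklore] -/
theorem length_encodeNat_natAbs_ediv_le (x d : ℤ) :
    (encodeNat (x / d).natAbs).length ≤ (encodeNat x.natAbs).length := by
  rw [TM2Pass.length_encodeNat_eq_size, TM2Pass.length_encodeNat_eq_size]
  exact Nat.size_le_size (Int.natAbs_ediv_le_natAbs x d)

/-- **Simulation of `pediv`** on canonical pairs. [Knuth 1998, §4.3.1, Algorithm D] [folklore] -/
theorem runs_pediv (x d : ℤ) (r₁ r₂ : List Bool) (L : ℕ)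
    (hx : (encodeNat x.natAbs).length ≤ L) (hd : (encodeNat d.natAbs).length ≤ L) :
    Runs pediv (Sum.elim (ZOwn.file (cP x) (cQ x) (cP d) (cQ d) r₁ r₂ [] []) (AReg.file [] [] [] [] [] [] [] []))
      (Sum.elim (ZOwn.file (cP (x / d)) (cQ (x / d)) (cP d) (cQ d) r₁ r₂ [] []) (AReg.file [] [] [] [] [] [] [] []))
      (pedivCost L) := by
  have hxL : (cP x).length + (cQ x).length ≤ L := by rw [length_cP_add_length_cQ]; exact hx
  have hdL : (cP d).length + (cQ d).length ≤ L := by rw [length_cP_add_length_cQ]; exact hd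
  have hne_of : ∀ z : ℤ, z ≠ 0 → encodeNat z.natAbs ≠ [] := by
    intro z hz h0; have := bitsToNat_encodeNat z.natAbs; rw [h0] at this; simp at this; omega
  rcases lt_trichotomy d 0 with hneg | rfl | hpos
  · -- negative divisor: divide by the magnitude, then negate
    have hP : cP d = [] := by simp [cP, hneg]
    have hQd : cQ d = encodeNat d.natAbs := by simp [cQ, hneg]
    obtain ⟨b, w, hbw⟩ : ∃ b w, cQ d = b :: w := by
      cases h : cQ d with | nil => exact absurd (hQd ▸ h) (hne_of d hneg.ne) | cons b w => exact ⟨b, w, rfl⟩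
    have hdn : 0 < bitsToNat (cQ d) := by
      have := bitsToNat_cQ d; rw [if_pos hneg] at this
      have : (bitsToNat (cQ d) : ℤ) > 0 := by linarith
      exact_mod_cast this
    set e := cQ d with he
    rw [hP]
    have e1 : Runs (push (.inl .Q₂) b : Com ZReg) (Sum.elim (ZOwn.file (cP x) (cQ x) [] w r₁ r₂ [] []) (AReg.file [] [] [] [] [] [] [] []))
        (Sum.elim (ZOwn.file (cP x) (cQ x) [] e r₁ r₂ [] []) (AReg.file [] [] [] [] [] [] [] [])) 1 :=
      Runs.push' (by rw [Sum.update_elim_inl]; simp [hbw])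
    have e2 := runs_move (ι := ZReg) (a := .inl .Q₂) (b := .inl .P₂) (t := .inr .t) (by decide) (by simp) (by simp)
      (Sum.elim (ZOwn.file (cP x) (cQ x) [] e r₁ r₂ [] []) (AReg.file [] [] [] [] [] [] [] [])) rfl
    simp only [Sum.elim_inl, ZOwn.file_Q₂, ZOwn.file_P₂, Sum.update_elim_inl, ZOwn.update_file_Q₂, ZOwn.update_file_P₂,
      List.append_nil] at e2
    have e3 := runs_pfdiv (cP x) (cQ x) e [] r₁ r₂ hdn
    obtain ⟨hq1, hq2⟩ := pfdiv_canonical x (bitsToNat e) hdn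
    rw [hq1, hq2] at e3
    set y := x / (bitsToNat e : ℤ) with hy
    have e4 := runs_move (ι := ZReg) (a := .inl .P₂) (b := .inl .Q₂) (t := .inr .t) (by decide) (by simp) (by simp)
      (Sum.elim (ZOwn.file (cP y) (cQ y) e [] r₁ r₂ [] []) (AReg.file [] [] [] [] [] [] [] [])) rfl
    simp only [Sum.elim_inl, ZOwn.file_Q₂, ZOwn.file_P₂, Sum.update_elim_inl, ZOwn.update_file_Q₂, ZOwn.update_file_P₂,
      List.append_nil] at e4
    have e5 := runs_pneg (cP y) (cQ y) [] e r₁ r₂ [] (AReg.file [] [] [] [] [] [] [] []) rfl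
    have hres : x / d = -y := by
      have hdv : (d : ℤ) = -(bitsToNat e : ℤ) := by have := bitsToNat_cQ d; rw [if_pos hneg] at this; linarith
      rw [hy, hdv, Int.ediv_neg]
    have hbody := e1.seq (e2.seq (e3.seq (e4.seq e5)))
    rw [hres, cP_neg, cQ_neg]
    have hle : e.length ≤ L := by have := hdL; rw [hP] at this; simpa using this
    have hly : (cP y).length + (cQ y).length ≤ L := by
      rw [length_cP_add_length_cQ]; exact (length_encodeNat_natAbs_ediv_le x _).trans hx
    have hcost : 1 + (6 * e.length + 2 + (((cP x).length + (cQ x).length) * (41 * e.length + 75) + 54 * e.length +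
        34 * (cQ x).length + 160 + (6 * e.length + 2 + (12 * ((cP y).length + (cQ y).length) + 6)))) + 2 + 2 ≤ pedivCost L := by
      unfold pedivCost
      have : ((cP x).length + (cQ x).length) * (41 * e.length + 75) ≤ L * (41 * L + 75) := Nat.mul_le_mul hxL (by omega)
      omega
    refine (Runs.pop_nil _ _ (by simp) ?_).of_eq rfl hcost
    cases b
    · exact Runs.pop_false' _ _ (R₀ := Sum.elim (ZOwn.file (cP x) (cQ x) [] w r₁ r₂ [] []) (AReg.file [] [] [] [] [] [] [] []))
        (w := w) (by simp [hbw]) (by rw [Sum.update_elim_inl]; simp) hbody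
    · exact Runs.pop_true' _ _ (R₀ := Sum.elim (ZOwn.file (cP x) (cQ x) [] w r₁ r₂ [] []) (AReg.file [] [] [] [] [] [] [] []))
        (w := w) (by simp [hbw]) (by rw [Sum.update_elim_inl]; simp) hbody
  · -- zero divisor: the quotient is `0`
    have hP : cP 0 = [] := by decide
    have hQ : cQ 0 = [] := by decide
    rw [Int.ediv_zero, hP, hQ]
    have c1 := runs_clear (ι := ZReg) (.inl .P₁) (Sum.elim (ZOwn.file (cP x) (cQ x) [] [] r₁ r₂ [] []) (AReg.file [] [] [] [] [] [] [] []))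
    simp only [Sum.elim_inl, ZOwn.file_P₁, Sum.update_elim_inl, ZOwn.update_file_P₁] at c1
    have c2 := runs_clear (ι := ZReg) (.inl .Q₁) (Sum.elim (ZOwn.file [] (cQ x) [] [] r₁ r₂ [] []) (AReg.file [] [] [] [] [] [] [] []))
    simp only [Sum.elim_inl, ZOwn.file_Q₁, Sum.update_elim_inl, ZOwn.update_file_Q₁] at c2
    refine (Runs.pop_nil _ _ (by simp) (Runs.pop_nil _ _ (by simp) (c1.seq c2))).of_eq rfl ?_
    unfold pedivCost; omega
  · -- positive divisor
    have hQ : cQ d = [] := by simp [cQ, not_lt.2 hpos.le]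
    have hPd : cP d = encodeNat d.natAbs := by simp [cP, not_lt.2 hpos.le]
    obtain ⟨b, w, hbw⟩ : ∃ b w, cP d = b :: w := by
      cases h : cP d with | nil => exact absurd (hPd ▸ h) (hne_of d hpos.ne') | cons b w => exact ⟨b, w, rfl⟩
    have hdn : 0 < bitsToNat (cP d) := by
      have := bitsToNat_cP d; rw [if_neg (not_lt.2 hpos.le)] at this
      have : (bitsToNat (cP d) : ℤ) > 0 := by linarith
      exact_mod_cast this
    set e := cP d with he
    rw [hQ]
    have e1 : Runs (push (.inl .P₂) b : Com ZReg) (Sum.elim (ZOwn.file (cP x) (cQ x) w [] r₁ r₂ [] []) (AReg.file [] [] [] [] [] [] [] []))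
        (Sum.elim (ZOwn.file (cP x) (cQ x) e [] r₁ r₂ [] []) (AReg.file [] [] [] [] [] [] [] [])) 1 :=
      Runs.push' (by rw [Sum.update_elim_inl]; simp [hbw])
    have e3 := runs_pfdiv (cP x) (cQ x) e [] r₁ r₂ hdn
    obtain ⟨hq1, hq2⟩ := pfdiv_canonical x (bitsToNat e) hdn
    rw [hq1, hq2] at e3
    have hdv : (d : ℤ) = (bitsToNat e : ℤ) := by have := bitsToNat_cP d; rw [if_neg (not_lt.2 hpos.le)] at this; linarith
    rw [show x / d = x / (bitsToNat e : ℤ) by rw [hdv]]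
    have hbody := e1.seq e3
    have hle : e.length ≤ L := by have := hdL; rw [hQ] at this; simpa using this
    have hcost : 1 + (((cP x).length + (cQ x).length) * (41 * e.length + 75) + 54 * e.length + 34 * (cQ x).length + 160) + 2 ≤
        pedivCost L := by
      unfold pedivCost
      have : ((cP x).length + (cQ x).length) * (41 * e.length + 75) ≤ L * (41 * L + 75) := Nat.mul_le_mul hxL (by omega)
      omega
    cases b
    · exact (Runs.pop_false' _ _ (R₀ := Sum.elim (ZOwn.file (cP x) (cQ x) w [] r₁ r₂ [] []) (AReg.file [] [] [] [] [] [] [] []))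
        (w := w) (by simp [hbw]) (by rw [Sum.update_elim_inl]; simp) hbody).of_eq rfl hcost
    · exact (Runs.pop_true' _ _ (R₀ := Sum.elim (ZOwn.file (cP x) (cQ x) w [] r₁ r₂ [] []) (AReg.file [] [] [] [] [] [] [] []))
        (w := w) (by simp [hbw]) (by rw [Sum.update_elim_inl]; simp) hbody).of_eq rfl hcost

end Com

end Literature.Computability.Complexity
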